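import Summits.QuantumFields.BalabanUV.T4Continuum.Support.NE7OneStepOfCritical
import Summits.QuantumFields.BalabanUV.T4Continuum.Support.NE7SegmentPlaquetteRadius
import Summits.QuantumFields.BalabanUV.T4Continuum.Support.NE7OneStepLetters
import Summits.QuantumFields.BalabanUV.T4Continuum.Support.AveragingDeficitFermat
import HarnessLib

/-!
# NE7ConvOneStepUnique — AT MOST ONE MINIMAL ORBIT, IN THE DICTIONARY: under the STRICT form of CONV-ONE-STEP's numeric line a competitor that
# is itself minimal has the ZERO representative direction — its gauge-fixed representative over the critical configuration `U♯` IS `U♯`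
# ([Balaban1985Variational] Prop. 7 «at most one critical orbit», the minimiser half, by strict convexity along the segment)

Cell `pub-balaban`, rung (B)+1 sub-cell t4, lineage `b2b-balaban-t4-ne7-p1`, generation 66 (CRUX PROVER NE7 #1); hunt (h10) «ONE-STEP = CRIT ∧ CONV»,
memo `t4/b2b-balaban-t4-ne7-p1-g66/HUNT-H10-TWO-ROADS.md` §2.  File F6 (over F1 `NE7OneStepOfCritical`, F2 `NE7SegmentPlaquetteRadius`, F3
`NE7OneStepLetters`).

WHAT ([folklore]; 0 def, 0 sorry).  F1–F4 give `A(U♯) ≤ A(U♯e^{X})` from `φ″ ≥ c`, `φ′(0) ≥ −κ`, `κ ≤ c∕2` along `φ(s) = A(U♯e^{sX})`.  The same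
Taylor bound is QUANTITATIVE: **`fineAction_vary_sub_ge`** `c∕2 − κ ≤ A(U♯e^{X}) − A(U♯)` (§1).  With the letters of F1 §4 (`c = c_X·dirSq X`,
`κ = κ_X·dirSq X`) and the STRICT line `2κ_X < c_X`, a competitor whose representative does NOT INCREASE the action (`A(U♯e^{X}) ≤ A(U♯)` — e.g. a
second minimiser) has `dirSq X (periodBox) = 0` (**`dirSq_eq_zero_of_poincare_slop`**, §2), hence `X = 0` everywhere by periodicity
(**`eq_zero_of_dirSq_eq_zero`**, §1) and `U♯e^{X} = U♯` (**`vary_eq_self_of_poincare_slop`**).  §3 **`vary_eq_self_of_critical_rep`** — the same in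
F4's currency (critical on a Poincaré slice `T`, split `X = X_T + X_N` with the two normal letters, strict line): for a competitor `U′` with
`levelAction U′ ≤ levelAction U♯` (a second minimiser) represented by `X`, `U♯e^{X} = U♯`; with REP's gauge identity `u·U′ = U♯e^{X}` this reads «a second
minimal configuration is a gauge transform of `U♯`» = Prop. 7's uniqueness, minimiser half, in the closed-class dictionary.  (The critical-point half
of Prop. 7 — two CRITICAL orbits coincide — needs the symmetric argument with the slop at both ends; not done here.)
HONEST FRAMING (page 1): convexity bookkeeping over HYPOTHESES (REP, the normal letters, criticality, (P♮)); nothing is asserted about Bałaban's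
minimisers; NOT ONE-STEP, NOT NE7; spine 0∕9; finite T⁴ rung (B)+1 — NOT infinite volume, NOT mass gap, NOT Clay.  Continuum YM on T⁴ ⇐ BetaPertH ∧
nine spine estimates (0/9 proved); BetaPertH ⇐ (D1) ∧ (D4) ∧ CAP+tail; G-an2-4 gates asym, D1 and NE2/3/4.
-/

set_option autoImplicit false

open scoped BigOperators Matrix.Norms.L2Operator
open NormedSpace Finset Set

namespace Summit.QuantumFields.BalabanUV.T4Continuum.NE7ConvOneStepUnique

open Literature.MathematicalPhysics.QuantumFieldTheory.Balaban1983to89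
open B7Prop1Explicit B7Prop2Explicit MatrixLog UnitaryModel
open T4AveragingDeficitWall (IsUnitaryCfg IsSkewDir SmallField fineAction vary curl curlSq dirSq vary_zero vary_zero_dir)
open T4AveragingDeficitWallBoundary (IsPeriodicCfg periodBox)
open AveragingDeficitPeriodicCounting (IsPeriodicDir)
open AveragingDeficitTorusChart (eq_wrap_add periodic_smul_vec)
open AveragingDeficitFermat (boxVec_redN_mem)
open T4ConvexResponse (taylor_lower)
open MinimalActionLevels (levelAction perWin stepWt stepWt_pos)
open MinimalActionSandwich (IsMinimiser admissible)
open NE3HessForm (hess dAction segment_derivData)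
open NE3HessShapes (plaqsOf)
open NE3SlicePoincareShape (SlicePoincare)
open NE7OneStepOfCritical (hess_vary_ge_of_poincare)
open NE7SegmentPlaquetteRadius (smallField_vary_segment_class)
open NE7OneStepLetters (slop_of_tangent_critical curlSq_ge_of_slicePoincare)

noncomputable section

variable {d : ℕ} {n : Type*} [Fintype n] [DecidableEq n]

/-! ## §1 The quantitative Taylor bound and periodic directions with zero ℓ² norm -/

/-- **`c∕2 − κ ≤ A(U e^{X}) − A(U)`** from `c ≤ hess (U e^{tX}) X X W` on `[0,1]` and `−κ ≤ dAction U X W` (`taylor_lower`). [folklore] -/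
theorem fineAction_vary_sub_ge (V : Site d → Fin d → (Matrix n n ℂ)ˣ) (X : Site d → Fin d → Matrix n n ℂ)
    (W : Finset (T4AveragingDeficitWall.Plaq d)) {c κ : ℝ} (hconv : ∀ t ∈ Icc (0 : ℝ) 1, c ≤ hess (vary V X t) X X W)
    (hleft : -κ ≤ dAction V X W) : c / 2 - κ ≤ fineAction (vary V X 1) W - fineAction V W := by
  obtain ⟨h1, h2⟩ := segment_derivData V X W
  have h := taylor_lower h1 h2 hconv
  rw [vary_zero] at h
  linarith

/-- **An `M`-periodic direction with `dirSq X (periodBox M) = 0` vanishes identically** (`M ≥ 1`). [folklore] -/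
theorem eq_zero_of_dirSq_eq_zero {M : ℕ} (hM : 1 ≤ M) {X : Site d → Fin d → Matrix n n ℂ} (hXP : IsPeriodicDir X M)
    (h0 : dirSq X (periodBox (d := d) M) = 0) : X = fun _ _ => 0 := by
  haveI : NeZero M := ⟨by omega⟩
  -- every term of the double sum vanishes
  have hterm : ∀ x ∈ periodBox (d := d) M, ∀ κ : Fin d, X x κ = 0 := by
    intro x hx κ
    unfold dirSq at h0
    have h1 := (Finset.sum_eq_zero_iff_of_nonneg fun y _ => Finset.sum_nonneg fun κ _ => sq_nonneg ‖X y κ‖).mp h0 x hx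
    have h2 := (Finset.sum_eq_zero_iff_of_nonneg fun κ _ => sq_nonneg ‖X x κ‖).mp h1 κ (Finset.mem_univ κ)
    have h3 : ‖X x κ‖ = 0 := pow_eq_zero_iff (n := 2) (by norm_num) |>.mp h2
    exact norm_eq_zero.mp h3
  funext x κ
  -- reduce `x` to the period box by periodicity
  have hx := eq_wrap_add M x
  have hper : X x κ = X (boxVec M (AveragingDeficitTorusChart.redN M x)) κ := by
    conv_lhs => rw [hx]
    exact periodic_smul_vec (f := fun y => X y κ) (fun y i => hXP y i κ) _ _
  rw [hper]
  exact hterm _ (boxVec_redN_mem M x) κ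

/-! ## §2 Strict convexity along the segment: a non-increasing competitor has the zero direction -/

/-- **`dirSq X = 0` FOR A COMPETITOR THAT DOES NOT INCREASE THE ACTION, UNDER THE STRICT LINE.**  Unitary `U`, skew `M`-periodic `X` (`M ≥ 1`) with
`‖X(b)‖ ≤ α` (`α ≥ 0`), Poincaré letter `m·dirSq X ≤ curlSq U X`, radius `a′ ≥ 0` of `U e^{tX}` on `[0,1]`, slop `−κ·dirSq X ≤ dAction U X` on
`plaqsOf (periodBox M)`, the STRICT line `2κ < (m∕2 − 576d(e^{α} − 1)²)∕card n − 28d·a′`, and `A(U e^{X}) ≤ A(U)` on that window ⟹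
`dirSq X (periodBox M) = 0`. [folklore] -/
theorem dirSq_eq_zero_of_poincare_slop [Nonempty n] {M : ℕ} (hM : 1 ≤ M) {U : Site d → Fin d → (Matrix n n ℂ)ˣ} (hU : IsUnitaryCfg U)
    {X : Site d → Fin d → Matrix n n ℂ} (hX : IsSkewDir X) (hXP : IsPeriodicDir X M) {α m a' κ : ℝ} (hα : 0 ≤ α)
    (hXα : ∀ x μ, ‖X x μ‖ ≤ α) (hP : m * dirSq X (periodBox (d := d) M) ≤ curlSq U X (periodBox (d := d) M)) (ha' : 0 ≤ a')
    (hrad : ∀ t ∈ Icc (0 : ℝ) 1, SmallField (vary U X t) a')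
    (hslop : -(κ * dirSq X (periodBox (d := d) M)) ≤ dAction U X (plaqsOf (periodBox (d := d) M)))
    (hline : 2 * κ < (m / 2 - 576 * d * (Real.exp α - 1) ^ 2) / (Fintype.card n : ℝ) - 28 * d * a')
    (hle : fineAction (vary U X 1) (plaqsOf (periodBox (d := d) M)) ≤ fineAction U (plaqsOf (periodBox (d := d) M))) :
    dirSq X (periodBox (d := d) M) = 0 := by
  set D := dirSq X (periodBox (d := d) M) with hD
  set cX := (m / 2 - 576 * d * (Real.exp α - 1) ^ 2) / (Fintype.card n : ℝ) - 28 * d * a' with hcX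
  have hD0 : 0 ≤ D := by rw [hD]; unfold dirSq; positivity
  have hconv : ∀ t ∈ Icc (0 : ℝ) 1, cX * D ≤ hess (vary U X t) X X (plaqsOf (periodBox (d := d) M)) :=
    fun t ht => hess_vary_ge_of_poincare hM hU hX hXP hα hXα hP ht ha' (hrad t ht)
  have hgap := fineAction_vary_sub_ge U X (plaqsOf (periodBox (d := d) M)) hconv hslop
  -- `(cX∕2 − κ)·D ≤ A(Ue^X) − A(U) ≤ 0` with `cX∕2 − κ > 0`
  have hpos : 0 < cX / 2 - κ := by linarith
  have hprod : (cX / 2 - κ) * D ≤ 0 := by nlinarith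
  have hDle : D ≤ 0 := by
    by_contra hcon
    have := mul_pos hpos (not_le.mp hcon)
    linarith
  linarith

/-- **HENCE THE REPRESENTATIVE IS `U` ITSELF**: under the hypotheses of `dirSq_eq_zero_of_poincare_slop`, `X = 0` and `U e^{X} = U`. [folklore] -/
theorem vary_eq_self_of_poincare_slop [Nonempty n] {M : ℕ} (hM : 1 ≤ M) {U : Site d → Fin d → (Matrix n n ℂ)ˣ} (hU : IsUnitaryCfg U)
    {X : Site d → Fin d → Matrix n n ℂ} (hX : IsSkewDir X) (hXP : IsPeriodicDir X M) {α m a' κ : ℝ} (hα : 0 ≤ α)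
    (hXα : ∀ x μ, ‖X x μ‖ ≤ α) (hP : m * dirSq X (periodBox (d := d) M) ≤ curlSq U X (periodBox (d := d) M)) (ha' : 0 ≤ a')
    (hrad : ∀ t ∈ Icc (0 : ℝ) 1, SmallField (vary U X t) a')
    (hslop : -(κ * dirSq X (periodBox (d := d) M)) ≤ dAction U X (plaqsOf (periodBox (d := d) M)))
    (hline : 2 * κ < (m / 2 - 576 * d * (Real.exp α - 1) ^ 2) / (Fintype.card n : ℝ) - 28 * d * a')
    (hle : fineAction (vary U X 1) (plaqsOf (periodBox (d := d) M)) ≤ fineAction U (plaqsOf (periodBox (d := d) M))) :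
    X = (fun _ _ => 0) ∧ vary U X 1 = U := by
  have h0 := eq_zero_of_dirSq_eq_zero hM hXP (dirSq_eq_zero_of_poincare_slop hM hU hX hXP hα hXα hP ha' hrad hslop hline hle)
  refine ⟨h0, ?_⟩
  rw [h0]
  exact vary_zero_dir U 1

/-! ## §3 In F4's currency: a second minimiser represented over the critical configuration has the zero direction -/

/-- **AT MOST ONE MINIMAL ORBIT (minimiser half of [Balaban1985Variational] Prop. 7, in the dictionary, modulo REP).**  `U♯ ∈ admissible 𝒞 L k V`
unitary with `SmallField U♯ a` (`a ≥ 0`), critical on a Poincaré slice `T` (`SlicePoincare L k U♯ T C (periodBox (N·L^k))`, `C > 0`;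
`dAction U♯ Y (perWin) = 0` for `Y ∈ T`); a competitor `U′` with `levelAction U′ ≤ levelAction U♯` (a second minimiser) REPRESENTED over `U♯` by a skew
periodic `X` (`‖X‖_∞ ≤ α`, `levelAction (U♯e^{X}) ≤ levelAction U′`, `SmallField (U♯e^{X}) a`, split `X = X_T + X_N`, `X_T ∈ T`, normal letters `θ`,
`C_N`) under the STRICT line `2aC_N < (m∕2 − 576d(e^α − 1)²)∕card n − 28d(a + 7α²)`, `m = (L^k)^{−2}∕(4C) − ((L^k)^{−2}∕(2C) + 16d)θ` ⟹ `X = 0` and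
`U♯e^{X} = U♯` (`L, N ≥ 1`). [folklore] -/
theorem vary_eq_self_of_critical_rep [Nonempty n] {𝒞 : ℕ → Set (Site d → Fin d → (Matrix n n ℂ)ˣ)} {L N k : ℕ} (hL : 1 ≤ L) (hN : 1 ≤ N)
    {V Us U' : Site d → Fin d → (Matrix n n ℂ)ˣ} (_hmem : Us ∈ admissible 𝒞 L k V) (hUs : IsUnitaryCfg Us) {a : ℝ} (ha : 0 ≤ a)
    (hUsa : SmallField Us a) {T : Set (Site d → Fin d → Matrix n n ℂ)} {C : ℝ} (hC : 0 < C)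
    (hP : SlicePoincare L k Us T C (periodBox (d := d) (N * L ^ k))) (hcrit : ∀ Y ∈ T, dAction Us Y (perWin d (N * L ^ k)) = 0)
    (hmin' : levelAction d L N k U' ≤ levelAction d L N k Us)
    {X XT XN : Site d → Fin d → Matrix n n ℂ} {α θ CN : ℝ} (hXs : IsSkewDir X) (hXP : IsPeriodicDir X ((N * L ^ k : ℕ) : ℤ)) (hα : 0 ≤ α)
    (hXα : ∀ x μ, ‖X x μ‖ ≤ α) (hle : levelAction d L N k (vary Us X 1) ≤ levelAction d L N k U') (h1 : SmallField (vary Us X 1) a)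
    (hsplit : X = XT + XN) (hXT : XT ∈ T) (hXNs : IsSkewDir XN) (hXNP : IsPeriodicDir XN ((N * L ^ k : ℕ) : ℤ))
    (hN2 : dirSq XN (periodBox (d := d) (N * L ^ k)) ≤ θ * dirSq X (periodBox (d := d) (N * L ^ k)))
    (hN1 : (∑ p ∈ perWin d (N * L ^ k), ‖curl Us XN p‖) ≤ CN * dirSq X (periodBox (d := d) (N * L ^ k)))
    (hline : 2 * (a * CN) < (((((((L : ℝ) ^ k)⁻¹) ^ 2 / C) / 4 - (((((L : ℝ) ^ k)⁻¹) ^ 2 / C) / 2 + 16 * d) * θ) / 2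
        - 576 * d * (Real.exp α - 1) ^ 2) / (Fintype.card n : ℝ) - 28 * d * (a + 7 * α ^ 2))) :
    X = (fun _ _ => 0) ∧ vary Us X 1 = Us := by
  have hN0 : 0 < N := hN
  have hL0 : 0 < L := hL
  have hM : 0 < N * L ^ k := Nat.mul_pos hN0 (Nat.pow_pos hL0)
  -- `perWin d M = plaqsOf (periodBox M)` (both `periodBox M ×ˢ univ`)
  have e : perWin d (N * L ^ k) = plaqsOf (periodBox (d := d) (N * L ^ k)) := rfl
  have hPX := curlSq_ge_of_slicePoincare hM hUs hC hP hsplit hXT hXNP hN2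
  have hrad : ∀ t ∈ Icc (0 : ℝ) 1, SmallField (vary Us X t) (a + 7 * α ^ 2) := fun t ht => smallField_vary_segment_class hUs hXs hUsa h1 hXα ht
  have hslop := slop_of_tangent_critical hUs ha hUsa hsplit hXNs (perWin d (N * L ^ k)) (periodBox (d := d) (N * L ^ k)) (hcrit XT hXT) hN1
  rw [e] at hslop
  -- the action comparison on the fine window from the level actions
  have hw : 0 < ((stepWt d L)⁻¹) ^ k := pow_pos (inv_pos.mpr (stepWt_pos (d := d) L hL)) _
  have hfine : fineAction (vary Us X 1) (plaqsOf (periodBox (d := d) (N * L ^ k))) ≤ fineAction Us (plaqsOf (periodBox (d := d) (N * L ^ k))) := by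
    have h := hle.trans hmin'
    unfold levelAction at h
    rw [e] at h
    exact le_of_mul_le_mul_left h hw
  exact vary_eq_self_of_poincare_slop hM hUs hXs hXP hα hXα hPX (by positivity) hrad hslop hline hfine

end

end Summit.QuantumFields.BalabanUV.T4Continuum.NE7ConvOneStepUnique
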